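import Literature.Topology.FourManifolds.HCobordismLevelDeformationIsotopy
import Literature.Topology.FourManifolds.HCobordismModelChart
import Literature.Topology.FourManifolds.RegularLevelSet
import HarnessLib

/-!
# Milnor 1965, proof of Thm. 5.4, Assertion 6, the general case: the deformation of `h` on the
# presented level `f⁻¹(b₂)`, and the trivial case of dimension one

Topic `Literature/Topology/FourManifolds` (fact seat
`provefact-Literature.Topology.FourManifolds.Cobord-288d2994d8`, towards the named fact
`Literature.Topology.FourManifolds.Cobordism.Milnor1965_cancellation_levelDeformation` of
`HCobordismLevelIsotopy.lean`; sequel of `HCobordismLevelDeformationIsotopy.lean`).  Milnor,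
*Lectures on the h-cobordism theorem* (1965), proof of Thm. 5.4, Assertion 6 (held copy, PDF
pp. 31–32).

* `CancellationFrame.DeformationData.exists_levelIsotopy` — **the second alternative of the named
  fact for a frame carrying deformation data** (i.e. once `h₀⁻¹h` is orientation-preserving with
  positive block `A`): the level `f⁻¹(b₂)` is presented by the closed manifold
  `Literature.Topology.FourManifolds.RegularLevel` (`RegularLevelSet.lean`, `n ≥ 1`), the
  `f`-preserving deformation `h̄_t ∘ h⁻¹` of `W` (`HCobordismLevelDeformationIsotopy.lean`) is
  restricted to it (`AmbientIsotopy.restrictOfPreserves`, `AmbientIsotopyRestrict.lean`), and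
  (I1), (I2) are read off from `isoW_h_eq_h₀`, `isoW_image_inter`.
* `CancellationFrame.levelMapsAgree_of_eq_zero` — **the first alternative when `n = 0`**: the
  levels are then discrete near `p₁` (the level coordinates `Rᵃ × Rᵇ` are a point), so every
  point of the level `b₁` near `p₁` in the chart is `p₁` itself, its translate is `p₂ = h₀ p₁`,
  and the supposition holds with nothing to deform.

Everything here is proved; no named facts.

## References

* J. Milnor, *Lectures on the h-cobordism theorem*, notes by L. Siebenmann and J. Sondow,
  Princeton Mathematical Notes (1965): proof of Thm. 5.4, Assertion 6 (PDF pp. 31–32).  Held: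
  `lit read book:milnornd-lectures-h-cobordism-theorem`. [MilnorHCobordism1965]
-/

open scoped Manifold ContDiff Topology NNReal
open Set Function Filter Metric

noncomputable section

namespace Literature.Topology.FourManifolds

open Flow

universe u

/-- Local notation: the model Euclidean space. -/
local notation "𝔼 " n:arg => EuclideanSpace ℝ (Fin n)

variable {n : ℕ} {M N : Type u} [TopologicalSpace M] [ChartedSpace (𝔼 n) M]
  [TopologicalSpace N] [ChartedSpace (𝔼 n) N]

namespace Cobordism

namespace CancellationFrame

variable {c : Cobordism n M N} {f : c.W → ℝ}
  {ξ : Cₛ^∞⟮𝓡∂ (n + 1); 𝔼 (n + 1), (TangentSpace (𝓡∂ (n + 1)) : c.W → Type)⟯}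
  {p p' : c.W} {k : ℕ} {v : ℝ → ℝ} {b₁ b₂ : ℝ}

/-- `b₂` is a regular value in `(0, 1)`. [folklore] -/
theorem b₂_mem_Ioo (D : CancellationFrame c f ξ p p' k v b₁ b₂) : b₂ ∈ Ioo (0 : ℝ) 1 :=
  ⟨(D.isMorseFunction.mem_Icc p).1.trans_lt (D.hpb₁.trans D.hb),
    D.hb₂p'.trans_le (D.isMorseFunction.mem_Icc p').2⟩

/-- No critical point of `f` has value `b₂`. [folklore] -/
theorem not_isMCriticalPt_of_eq_b₂ (D : CancellationFrame c f ξ p p' k v b₁ b₂) :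
    ∀ z, IsMCriticalPt (𝓡∂ (n + 1)) f z → f z ≠ b₂ :=
  fun z hz hzb => D.reg_level ⟨D.hpb₁.trans D.hb, D.hb₂p'⟩ z hzb hz

namespace DeformationData

variable {D : CancellationFrame c f ξ p p' k v b₁ b₂} (Δ : DeformationData D)

include Δ in
/-- **The second alternative of `Milnor1965_cancellation_levelDeformation` for a frame carrying
deformation data**: the level `f⁻¹(b₂)` presented by a closed manifold `V`, an ambient isotopy
`F` of `V` (the restriction of `h̄_t ∘ h⁻¹`), with (I1) `h̄ = h₀` near `p₁` and (I2)
`h̄(S_R(b₁)) ∩ S_L'(b₂)` a single point. [cite: MilnorHCobordism1965, proof of Thm. 5.4, Assertion 6 (PDF pp. 31–32)] -/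
theorem exists_levelIsotopy [NeZero n] :
    ∃ (V : Type u) (_ : TopologicalSpace V) (_ : T2Space V) (_ : SecondCountableTopology V)
      (_ : CompactSpace V) (_ : ChartedSpace (𝔼 n) V) (_ : IsManifold (𝓡 n) ∞ V)
      (ι : V → c.W) (_ : Manifold.IsSmoothEmbedding (𝓡 n) (𝓡∂ (n + 1)) ∞ ι)
      (_ : range ι = f ⁻¹' {b₂}) (F : AmbientIsotopy (𝓡 n) V),
      (∃ U ∈ 𝓝 (D.G₁.symm (D.t₁ • EuclideanSpace.single (0 : Fin (n + 1)) (1 : ℝ))),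
        U ⊆ D.G₁.source ∧
        ∀ z ∈ U, f z = b₁ → ∀ w : V, FlowsTo (𝓡∂ (n + 1)) ξ z (ι w) →
          ι (F.toFun 1 w) ∈ D.G₂.source ∧
            FlowsTo 𝓘(ℝ, 𝔼 (n + 1))
              (fun x : 𝔼 (n + 1) => (milnorCancellationField k v x : TangentSpace 𝓘(ℝ, 𝔼 (n + 1)) x))
              (D.G₁ z) (D.G₂ (ι (F.toFun 1 w)))) ∧
      ∃ x₂ : c.W, ι '' (F.toFun 1 '' (ι ⁻¹' rightHandSphere (𝓡∂ (n + 1)) f ξ p b₂)) ∩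
        leftHandSphere (𝓡∂ (n + 1)) f ξ p' b₂ = {x₂} := by
  obtain ⟨V, _, _, _, _, _, _, ι, hι, hrange⟩ :=
    D.isMorseFunction.exists_isSmoothEmbedding_range_eq D.b₂_mem_Ioo D.not_isMCriticalPt_of_eq_b₂
  set F := Δ.isoW.restrictOfPreserves hι hrange Δ.f_isoW with hF
  refine ⟨V, inferInstance, inferInstance, inferInstance, inferInstance, inferInstance, inferInstance,
    ι, hι, hrange, F, ?_, D.p₂, ?_⟩
  · obtain ⟨U, hU, hUG, hprop⟩ := Δ.isoW_h_eq_h₀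
    refine ⟨U, hU, hUG, fun z hz hzb w hflow => ?_⟩
    obtain ⟨heq, hmem, hfl⟩ := hprop z hz hzb
    have hzslab : f z ∈ Icc (b₁ - D.δ) (b₂ + D.δ) := by
      rw [hzb]
      exact D.b₁_mem
    have hιb : f (ι w) = b₂ := by
      have : ι w ∈ f ⁻¹' {b₂} := hrange ▸ mem_range_self w
      exact this
    have hιw : ι w = D.h z := D.eq_h_of_flowsTo hzslab hιb hflow
    have h1 : ι (F.toFun 1 w) = Δ.isoW.toFun 1 (D.h z) := by
      rw [hF, Δ.isoW.apply_restrictOfPreserves hι hrange Δ.f_isoW 1 w, hιw]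
    rw [h1, heq]
    exact ⟨hmem, hfl⟩
  · rw [hF, AmbientIsotopy.image_image_restrictOfPreserves, image_preimage_eq_inter_range, hrange,
      inter_eq_left.2 rightHandSphere_subset_preimage]
    exact Δ.isoW_image_inter

end DeformationData

/-! ### Dimension one: the levels are discrete near `p₁` -/

/-- In dimension `n + 1 = 1` the level coordinates are a point. [folklore] -/
theorem subsingleton_coords_of_eq_zero (hn : n = 0) (D : CancellationFrame c f ξ p p' k v b₁ b₂) :
    Subsingleton (𝔼 (n - k) × 𝔼 k) := by
  have hk : k = 0 := by have := D.hk; omega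
  subst hn
  subst hk
  refine ⟨fun a b => Prod.ext ?_ ?_⟩ <;> (ext i; exact i.elim0)

/-- **The first alternative of `Milnor1965_cancellation_levelDeformation` in dimension
`n + 1 = 1`**: the levels are finite, every point of the level `b₁` near `p₁` in the chart of
`g₁` is `p₁`, whose translate along `ξ` is `p₂ = h₀ p₁`; so the supposition of PDF p. 31 holds
for the given charts, and `S_R(b₂) ∩ S_L'(b₂)` is the single point `p₂`. [cite: MilnorHCobordism1965, proof of Thm. 5.4, Assertion 6 (PDF pp. 31–32)] -/
theorem levelMapsAgree_of_eq_zero (hn : n = 0) (D : CancellationFrame c f ξ p p' k v b₁ b₂) :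
    CancellationLevelMapsAgree (𝓡∂ (n + 1)) f ξ k D.G₁ D.G₂ v b₁ b₂ D.t₁ ∧
      ∃ x₂ : c.W, rightHandSphere (𝓡∂ (n + 1)) f ξ p b₂ ∩ leftHandSphere (𝓡∂ (n + 1)) f ξ p' b₂ = {x₂} := by
  haveI := subsingleton_coords_of_eq_zero hn D
  refine ⟨?_, D.p₂, D.inter₂⟩
  have hS : ∀ᶠ z in 𝓝 D.p₁, D.G₁ z ∈ D.S₁.source := by
    apply (D.G₁.continuousAt D.p₁_mem).preimage_mem_nhds
    rw [D.G₁_p₁]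
    exact D.S₁.open_source.mem_nhds D.mem₁
  obtain ⟨U, hU, hUsub⟩ : ∃ U ∈ 𝓝 D.p₁, U ⊆ {z | z ∈ D.G₁.source ∧ D.G₁ z ∈ D.S₁.source} :=
    ⟨_, inter_mem (D.G₁.open_source.mem_nhds D.p₁_mem) hS, fun z hz => ⟨hz.1, hz.2⟩⟩
  refine ⟨U, hU, fun z hz => (hUsub hz).1, fun z hz hzb y hyb hflow => ?_⟩
  obtain ⟨hzG, hzS⟩ := hUsub hz
  -- `z = lift₁ (ψ₁ z) = lift₁ 0 = p₁`
  have hz₁ : z = D.p₁ := by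
    rw [← D.lift₁_ψ₁ hzG hzS hzb, Subsingleton.elim (D.ψ₁ z) 0, D.lift₁_zero]
  subst hz₁
  -- its translate is `p₂`
  have hy : y = D.p₂ := by
    rw [← D.h_p₁]
    exact D.eq_h_of_flowsTo (by rw [D.f_p₁]; exact D.b₁_mem) hyb hflow
  subst hy
  refine ⟨D.p₂_mem, ?_⟩
  rw [D.G₁_p₁, D.G₂_p₂, ← D.Λ_t₁]
  exact D.flowsTo_Λ (by simpa using D.t₁_mem) (by rw [D.morse_t₁]; exact D.hb.le) D.hitsUp_t₁

end CancellationFrame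

end Cobordism

end Literature.Topology.FourManifolds
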